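import Mathlib
import Summits.ValiantsHypothesis.ValiantsHypothesis.Theorems.GrenetZeonTwoDimCoefficientsDefs
import Summits.ValiantsHypothesis.ValiantsHypothesis.Theorems.GrenetZeonTwoDimCoefficientsDualUnipotentBaseNormalForm
import Summits.ValiantsHypothesis.ValiantsHypothesis.Theorems.GrenetZeonTwoDimCoefficientsDualUnipotentConstrainedPencil
import Summits.ValiantsHypothesis.ValiantsHypothesis.Theorems.GrenetZeonTwoDimCoefficientsDualUnipotentConstDir

/-!
# Crux `GrenetZeon.TwoDimCoefficients` (stmt-ValiantsHypothesis-8062), stub `stub_dualUnipotent`: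
# the unipotent dual model is the NILPOTENT POWER-TRACE model (`per_n = tr(E · N(x)^n)`, `E` constant)

The tree knows the stub's model in two currencies: the unipotent dual representation
`per_n = α·det A + β·tr(adj A · B)` (`det A ≡ c ≠ 0`; `DualUnipotentRepr n m`) and the constrained
nilpotent pencil `per_n = tr(N^{n−1}·M)`, `N`, `M` LINEAR `m × m`, `N^m = 0`, `tr(N^j·M) = 0` for
`j ≠ n − 1` (`dualUnipotentRepr_iff_constrainedPencil`, `…DualUnipotentConstrainedPencil.lean`).
This file removes the second matrix of forms: with the `2m × 2m` linear pencil
`Ñ = [[N, M], [0, 0]]` (`Ñ^{k+1} = [[N^{k+1}, N^k M], [0, 0]]`, `fromBlocks_zero₂_pow_succ`) and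
the CONSTANT square-zero corner `E = [[0, 0], [1, 0]]`,

  `tr(Ñ^j · E) = tr(N^{j−1}·M)`  (`j ≥ 1`),  `tr(E) = 0`,

so (`exists_powerTrace_of_dualUnipotentRepr`) a unipotent dual representation of size `m` makes
`per_n` a CONSTANT LINEAR FUNCTIONAL OF THE `n`-TH POWER of ONE nilpotent linear pencil of size
`2m`:

  `per_n(x) = tr(E · Ñ(x)^n)`,   `Ñ` linear, `Ñ^{2m} = 0`, `E² = 0`, `tr(E · Ñ(x)^j) = 0 (j ≠ n)`,

and conversely (`dualUnipotentRepr_of_powerTrace`, via `dualUnipotentRepr_of_constrainedPencil`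
with `M = N·E`) such a power-trace representation of size `m'` IS a unipotent dual representation
of size `m'`.  Hence the stub in its leanest currency (`dualUnipotentBound_iff_powerTrace`):

  `DualUnipotentBound` ⟺ ∃ C n₀, ∀ n ≥ n₀, ∀ m: if `per_n ∈ ℂ`-span of the entries of `N(x)^n` for a
  nilpotent LINEAR pencil `N` of size `m` (weight `E` constant, the other power traces against `E`
  vanishing), then `n² ≤ C·m`

— the NILPOTENT POWER-TRACE WIDTH of the permanent is linear in the number of variables.  (The
factor `2` between the two directions is absorbed in `C`.)  This isolates what a proof must do:
bound from below the size of a linear space of nilpotent matrices `𝒩 ∋ N(x)` on which the single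
polynomial map `N ↦ N^n` has `per_n` as a linear projection; the direction/closing matrix carries
no structure (cf. `dualUnipotentRepr_constDir`, `…DualUnipotentConstDir.lean`).

HONEST FRAMING: a reformulation (bookkeeping, factor `2`) of an open-problem-grade stub of an
ASIDE item; `DualUnipotentBound` stays open; `VP ≠ VNP` is not moved by anything here.

References: L. G. Valiant, Completeness classes in algebra, STOC 1979, §2 (one matrix power
encodes all path lengths of a nilpotent adjacency matrix); T. Mignon, N. Ressayre, Int. Math.
Res. Not. 2004:79 (context).
-/

-- single-conjunct layout `Summits/ValiantsHypothesis/ValiantsHypothesis`: the duplicated namespace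
-- component is mandated by the tree.
set_option linter.dupNamespace false

noncomputable section

namespace Summit.ValiantsHypothesis.ValiantsHypothesis.Cruxes.TwoDimCoefficients.DimTwoCases

open MvPolynomial Matrix
open Literature.Computability.AlgebraicComplexity

/-! ### Block bookkeeping: powers of `[[N, M], [0, 0]]` against the corner `[[0, 0], [1, 0]]` -/

section Blocks

variable {R : Type*} [CommRing R] {p : Type*} [Fintype p] [DecidableEq p]

/-- `[[N, M], [0, 0]]^{k+1} = [[N^{k+1}, N^k·M], [0, 0]]`. [folklore] -/
theorem fromBlocks_zero₂_pow_succ (N M : Matrix p p R) (k : ℕ) :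
    (fromBlocks N M (0 : Matrix p p R) (0 : Matrix p p R)) ^ (k + 1) =
      fromBlocks (N ^ (k + 1)) (N ^ k * M) 0 0 := by
  induction k with
  | zero => rw [zero_add, pow_one, pow_one, pow_zero, Matrix.one_mul]
  | succ k ih =>
    rw [pow_succ, ih, fromBlocks_multiply, Matrix.mul_zero, Matrix.mul_zero, add_zero, add_zero,
      Matrix.zero_mul, Matrix.zero_mul, add_zero, ← pow_succ]

/-- `tr([[P, Q], [0, 0]] · [[0, 0], [1, 0]]) = tr Q`. [folklore] -/
theorem trace_fromBlocks_zero₂_mul_corner (P Q : Matrix p p R) :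
    (fromBlocks P Q (0 : Matrix p p R) (0 : Matrix p p R) *
      fromBlocks (0 : Matrix p p R) (0 : Matrix p p R) (1 : Matrix p p R) (0 : Matrix p p R)).trace =
      Q.trace := by
  rw [fromBlocks_multiply, trace_fromBlocks_diag]
  simp

omit [DecidableEq p] in
/-- Re-indexing along an equivalence preserves the trace. [folklore] -/
theorem trace_submatrix_equiv_self {q : Type*} [Fintype q] (e : q ≃ p) (X : Matrix p p R) :
    (X.submatrix e e).trace = X.trace := by
  simp only [Matrix.trace, diag_apply, submatrix_apply]
  exact Equiv.sum_comp e (fun i => X i i)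

end Blocks

variable {n m : ℕ}

/-! ### Unipotent dual representation ⟹ power trace (width `m ↦ 2m`) -/

/-- **Power-trace form.**  A unipotent dual representation of `per_n` (`n ≥ 1`) of size `m`
yields a LINEAR `2m × 2m` pencil `Ñ` with `Ñ^{2m} = 0` and a CONSTANT matrix `E` with `E² = 0`
such that `per_n = tr(Ñ^n · E)` and `tr(Ñ^j · E) = 0` for every `j ≠ n`. [folklore] -/
theorem exists_powerTrace_of_dualUnipotentRepr (hn : 1 ≤ n) (h : DualUnipotentRepr n m) :
    ∃ (N : AffMat n (m + m)) (E : Matrix (Fin (m + m)) (Fin (m + m)) ℂ),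
      (∀ i j, (N i j).IsHomogeneous 1) ∧ N ^ (m + m) = 0 ∧ E * E = 0 ∧
      perPoly (Fin n) ℂ = (N ^ n * E.map C).trace ∧
      ∀ j : ℕ, j ≠ n → (N ^ j * E.map C).trace = 0 := by
  obtain ⟨N, M, hN, hM, hnil, hper, hcon⟩ := exists_constrained_pencil_of_dualUnipotentRepr hn h
  let e : Fin m ⊕ Fin m ≃ Fin (m + m) := finSumFinEquiv
  let φ := Matrix.reindexAlgEquiv ℂ (MvPolynomial (Fin n × Fin n) ℂ) e
  let X : Matrix (Fin m ⊕ Fin m) (Fin m ⊕ Fin m) (MvPolynomial (Fin n × Fin n) ℂ) :=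
    fromBlocks N M 0 0
  let K : Matrix (Fin m ⊕ Fin m) (Fin m ⊕ Fin m) (MvPolynomial (Fin n × Fin n) ℂ) :=
    fromBlocks 0 0 1 0
  let E₀ : Matrix (Fin m ⊕ Fin m) (Fin m ⊕ Fin m) ℂ := fromBlocks 0 0 1 0
  have hE₀ : E₀.map (C : ℂ → MvPolynomial (Fin n × Fin n) ℂ) = K := by
    simp only [E₀, K, fromBlocks_map, Matrix.map_zero (C : ℂ → MvPolynomial (Fin n × Fin n) ℂ) C_0,
      Matrix.map_one (C : ℂ → MvPolynomial (Fin n × Fin n) ℂ) C_0 C_1]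
  have hmap : (reindex e e E₀).map (C : ℂ → MvPolynomial (Fin n × Fin n) ℂ) = φ K := by
    rw [reindex_apply, ← submatrix_map, hE₀, Matrix.coe_reindexAlgEquiv, reindex_apply]
  -- traces of powers against the corner
  have htr : ∀ j : ℕ, (φ X ^ j * φ K).trace = if j = 0 then 0 else (N ^ (j - 1) * M).trace := by
    intro j
    rw [← map_pow, ← map_mul, Matrix.coe_reindexAlgEquiv, reindex_apply, trace_submatrix_equiv_self]
    rcases j with _ | j
    · rw [if_pos rfl, pow_zero, Matrix.one_mul, trace_fromBlocks_diag, Matrix.trace_zero, add_zero]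
    · rw [if_neg (Nat.succ_ne_zero j), Nat.add_sub_cancel, fromBlocks_zero₂_pow_succ,
        trace_fromBlocks_zero₂_mul_corner]
  refine ⟨φ X, reindex e e E₀, ?_, ?_, ?_, ?_, ?_⟩
  · -- linear entries
    intro i j
    rw [Matrix.coe_reindexAlgEquiv, reindex_apply, submatrix_apply]
    rcases e.symm i with a | a <;> rcases e.symm j with b | b
    · simpa only [X, fromBlocks_apply₁₁] using hN a b
    · simpa only [X, fromBlocks_apply₁₂] using hM a b
    · simpa only [X, fromBlocks_apply₂₁, Matrix.zero_apply] using isHomogeneous_zero _ _ 1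
    · simpa only [X, fromBlocks_apply₂₂, Matrix.zero_apply] using isHomogeneous_zero _ _ 1
  · -- nilpotent
    rcases Nat.eq_zero_or_pos m with hm | hm
    · subst hm
      exact Matrix.ext fun i _ => Fin.elim0 i
    · obtain ⟨k, hk⟩ : ∃ k, m + m = (m + 1) + k := ⟨m - 1, by omega⟩
      have hX : X ^ (m + 1) = 0 := by
        rw [fromBlocks_zero₂_pow_succ, pow_succ, hnil, Matrix.zero_mul, Matrix.zero_mul,
          fromBlocks_zero]
      have hX' : X ^ (m + m) = 0 := by rw [hk, pow_add, hX, Matrix.zero_mul]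
      rw [← map_pow, hX', map_zero]
  · -- square-zero direction
    rw [reindex_apply, submatrix_mul_equiv, corner_mul_corner]; rfl
  · -- the permanent
    rw [hmap, htr n, if_neg (by omega), ← hper]
  · -- the other power traces vanish
    intro j hj
    rw [hmap, htr j]
    split_ifs with hj0
    · rfl
    · exact hcon (j - 1) (by omega)

/-! ### Power trace ⟹ unipotent dual representation (same width) -/

/-- **Converse.**  A power-trace representation `per_n = tr(N^n · E)` (`n ≥ 1`; `N` affine
`m' × m'` with `N^{m'} = 0`, `E` constant, `tr(N^j · E) = 0` for `j ≠ n`) IS a unipotent dual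
representation of size `m'` (`A = 1 − N`, `B = N·E`). [folklore] -/
theorem dualUnipotentRepr_of_powerTrace {m' : ℕ} (hn : 1 ≤ n) (N : AffMat n m')
    (E : Matrix (Fin m') (Fin m') ℂ) (hN : IsAffine N) (hnil : N ^ m' = 0)
    (hper : perPoly (Fin n) ℂ = (N ^ n * E.map C).trace)
    (hcon : ∀ j : ℕ, j ≠ n → (N ^ j * E.map C).trace = 0) : DualUnipotentRepr n m' := by
  refine dualUnipotentRepr_of_constrainedPencil N (N * E.map C) hN (isAffine_mul_map_C N hN E)
    hnil ?_ (fun j _ hj => ?_)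
  · rw [← Matrix.mul_assoc, ← pow_succ, Nat.sub_add_cancel hn]; exact hper
  · rw [← Matrix.mul_assoc, ← pow_succ]; exact hcon (j + 1) (by omega)

/-! ### The stub in power-trace currency -/

/-- **`DualUnipotentBound` ⟺ the nilpotent power-trace width of `per_n` is `≥ n²/C`.**  The stub
`stub_dualUnipotent` is EQUIVALENT to: there are `C`, `n₀` such that for `n ≥ n₀`, whenever
`per_n = tr(N^n · E)` for a LINEAR `m × m` pencil `N` with `N^m = 0` and a CONSTANT matrix `E`
with `tr(N^j · E) = 0` for all `j ≠ n`, then `n² ≤ C·m`. [folklore] -/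
theorem dualUnipotentBound_iff_powerTrace :
    DualUnipotentBound ↔
      ∃ C n₀ : ℕ, ∀ n ≥ n₀, ∀ m : ℕ,
        (∃ (N : AffMat n m) (E : Matrix (Fin m) (Fin m) ℂ), (∀ i j, (N i j).IsHomogeneous 1) ∧
          N ^ m = 0 ∧ perPoly (Fin n) ℂ = (N ^ n * E.map MvPolynomial.C).trace ∧
          ∀ j : ℕ, j ≠ n → (N ^ j * E.map MvPolynomial.C).trace = 0) → n ^ 2 ≤ C * m := by
  constructor
  · rintro ⟨C, n₀, h⟩
    refine ⟨C, max n₀ 1, fun n hn m hP => h n (le_of_max_le_left hn) m ?_⟩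
    obtain ⟨N, E, hN, hnil, hper, hcon⟩ := hP
    exact dualUnipotentRepr_of_powerTrace (le_of_max_le_right hn) N E
      (fun i j => (hN i j).totalDegree_le) hnil hper hcon
  · rintro ⟨C, n₀, h⟩
    refine ⟨2 * C, max n₀ 1, fun n hn m hrep => ?_⟩
    obtain ⟨N, E, hN, hnil, -, hper, hcon⟩ :=
      exists_powerTrace_of_dualUnipotentRepr (le_of_max_le_right hn) hrep
    have := h n (le_of_max_le_left hn) (m + m) ⟨N, E, hN, hnil, hper, hcon⟩
    calc n ^ 2 ≤ C * (m + m) := this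
      _ = 2 * C * m := by ring

end Summit.ValiantsHypothesis.ValiantsHypothesis.Cruxes.TwoDimCoefficients.DimTwoCases

end
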